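import Literature.AnabelianGeometry.SemiGraphs.TemperedCurveTowerOfSpecialFibreTower
import Literature.AnabelianGeometry.SemiGraphs.TemperedAnabelianSec6DeltaOfTowerProofs
import Literature.AnabelianGeometry.SemiGraphs.TemperedAnabelianThm64OfTowerProofs
import HarnessLib

/-!
# [SemiAnbd] §6 (Lem. 6.1 (ii)(iii), Lem. 6.3 (ii)(iii), Thm. 6.4, Thm. 6.6) REDUCED to Example 3.10's
# special-fibre tower: the André tower input `htower₀` eliminated as a raw binder

Mochizuki, *Semi-graphs of anabelioids*, Publ. RIMS **42** (2006) [SemiAnbd]: Lemma 6.1 (ii)(iii) p. 69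
("`N_{Δ_X}(Δ^temp_X) = Δ^temp_X`", "`N_{Π_{X_K}}(Π^temp_{X_K}) = Π^temp_{X_K}`"; print: [André] Cor. 6.2.2),
Lemma 6.3 (ii)(iii) p. 70, Theorem 6.4 pp. 70–71, Theorem 6.6 pp. 72–73, all for a hyperbolic curve `X_K`
over a finite extension `K` of `ℚ_p`; Example 3.10 pp. 43–45 ("an exhaustive sequence of open characteristic
… subgroups … `⊆ N_i ⊆ … ⊆ Δ`", "`Δ ↠ … ↠ Δ[i] := π₁^temp(𝒢_i) ⋊^out Δ_i`", "`Δ` is the inverse limit of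
the `Δ[i]`"). [cite: MochizukiSemiAnbd2006, §6 pp.69-73; Ex 3.10 pp.43-45]

PROOF-ONLY file (abc-iut cell, D-0079 L-F sub-cell [SemiAnbd]+[CombGC], pack D «§6 tempered anabelian»,
seat abc-iut-f-174 gen 4, rows F-1706 / F-1663 / F-1678 (Lem. 6.1), F-1705 / F-1662 / F-2837 (Lem. 6.3),
F-1693 (Thm. 6.4), F-1707 (Thm. 6.6); no definition, no instance, no new named fact).  The tree's closers
of these rows (`TemperedCurve.profiniteNormalizers_of_tower`, `denseSubgroups_of_tower`,
`openDenseDOFConjugator_of_tower`, `temperedAnabelianTheorem_of_tower`, `profiniteOuterIsoLifts_of_system`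
with `piTempNormallyTerminal_of_tower`; seats abc-iut-w5-d139 / w5-d240) all consume ONE raw structural
binder `htower₀` for `Π^temp_{X_K}` ([André 2003] §4.5: cofinal open normal `N` with `Π^temp_{X_K}/N`
containing a free, normal, finite-index, finite-rank, non-abelian subgroup).  abc-iut-w5-d240's BRIDGE
`TemperedCurve.tower_of_specialFibreTower'` (`TemperedCurveTowerOfSpecialFibreTower.lean`) derives
`htower₀` from the data of Example 3.10.  This file performs the knit, so that every row reads, in ONE
theorem, as a consequence of the following LEAVES, each a NAMED BINDER displayed in the statement:

* (L-η′) `d : X.GroupLevelData` — "`Π^temp_{X_K}` tempered, Galois-countable, temp-slim, …" (Ex. 3.10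
  p. 43 / p. 45, [IUTchI] Rmk. 2.5.3 (i)); abc-iut-L3-lead ruling η′;
* (L-Ex310) `T : SpecialFibreTower X.DeltaTemp` (seat abc-iut-w5-d122) with (P0) `hP0` "the admissible
  kernels are normal in `Π^temp_{X_K}`" (= field `SpecialFibreTower.PiData.admKer_normal_pi` of seat
  abc-iut-L3-t2; [IUTchI] p. 50) and (h1) `hlim` "`Δ` is the inverse limit of the `Δ[i]`" (p. 45) read
  topologically — the kernel currency of the [André] §4 leaf;
* (L-B1′) `hch` — at every level chart `π₁^temp(𝒢_i)` a CHARACTERISTIC André tower: the MODEL theorem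
  recorded as GAP-LEDGER row G-w5d240-1 (tree theorem without the invariance clause:
  `TemperedPiChart.tower_of_isClosedEdge`); a binder here, never assumed silently;
* the row's own printed input: Thm. 6.4 — the instance forms `GeometricIsDFG C`,
  `GeometricIsGaloisCompatible C` (functoriality of `π₁^temp`) and `ProfiniteAnabelianTheorem C` ([Mzk8]
  Thm. 1.2 = [Mochizuki 1999] Thm. A, FACT-LIST F-2836); Thm. 6.6 — the specialisation isomorphism systems
  of its printed proof (`SpecializationIsoSystem`, [Mzk3] Lem. 2.3 / §3).

SATISFIABILITY of (L-B1′) at a genuine curve (honest note for the pack-D leaf census): `hch` is stated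
for EVERY level `i`; a level whose dual semi-graph has no closed edge has COMPACT `π₁^temp`
(`ProfiniteSemiGraph.temperedPi_compactSpace_of_forall_not_isClosedEdge`, abc-iut-w5-d240), which admits
no free non-abelian finite-index subquotient — so `T` is to be taken starting at a level with SINGULAR
stable reduction (re-index the printed tower), which exists for every proper hyperbolic curve over a
finite extension of `ℚ_p` by Tamagawa, *Resolution of nonsingularities of families of curves*, Publ. RIMS
**40** (2004), Thm. 0.2 (iv)(v).  Nothing of this is used below; it only explains how the binders are
meant to be instantiated.

What is proved: for each row, (a) the curve-level instance form at `X : TemperedCurve p` from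
{(L-η′), (L-Ex310), (L-B1′)} (+ the row's input), and (b) the origin-quantified printed form
(`TemperedOrigin.…Holds`, `TemperedMorphismOrigin.TemperedAnabelianTheoremHolds`) from the hypothesis
that every CERTIFIED curve carries these leaves.  Pure composition of landed theorems; classical; the
leaves are hypotheses, not assertions; nothing here takes a side on [IUTchIII] Cor. 3.12; typed ≠ proved.
-/

noncomputable section

namespace Literature.AnabelianGeometry.SemiGraphs

open _root_.Topology

namespace TemperedCurve

variable {p : ℕ} [Fact p.Prime] (X : TemperedCurve p)

/-! ### Lemma 6.1 (ii), (iii) — rows F-1663, F-1678, F-1706 -/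

/-- **[SemiAnbd] Lemma 6.1 (ii) at `X` from Example 3.10's special-fibre tower** (row F-1663
`DeltaTempNormallyTerminal`: `N_{Δ_X}(Δ^temp_X) = Δ^temp_X`): leaves (L-η′) `d`, (L-Ex310) `T`, `hP0`,
`hlim`, (L-B1′) `hch`; the raw `htower₀` binder of `deltaTempNormallyTerminal_of_tower` is supplied by
`tower_of_specialFibreTower'`. [cite: MochizukiSemiAnbd2006, Lem 6.1(ii) p.69] -/
theorem deltaTempNormallyTerminal_of_specialFibreTower (d : X.GroupLevelData)
    (T : SpecialFibreTower X.DeltaTemp)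
    (hP0 : ∀ i, ((T.admKer i).map X.DeltaTemp.subtype).Normal)
    (hlim : ∀ U ∈ 𝓝 (1 : X.DeltaTemp), ∃ i, ∃ V ∈ 𝓝 (1 : (T.chart i).G),
      ∀ n : T.N i, T.adm i n ∈ V → (n : X.DeltaTemp) ∈ U)
    (hch : ∀ i, ∀ V ∈ 𝓝 (1 : (T.chart i).G), ∃ MQ : OpenNormalSubgroup (T.chart i).G,
      (MQ : Set (T.chart i).G) ⊆ V ∧
      (∀ φ : (T.chart i).G ≃ₜ* (T.chart i).G,
        MQ.toSubgroup.map φ.toMulEquiv.toMonoidHom ≤ MQ.toSubgroup) ∧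
      ∃ (G : Subgroup ((T.chart i).G ⧸ MQ.toSubgroup)) (_ : IsFreeGroup G), G.FiniteIndex ∧
        Finite (IsFreeGroup.Generators G) ∧ ∃ a ∈ G, ∃ b ∈ G, a * b ≠ b * a) :
    X.DeltaTempNormallyTerminal :=
  X.deltaTempNormallyTerminal_of_tower d (X.tower_of_specialFibreTower' d T hP0 hlim hch)

/-- **[SemiAnbd] Lemma 6.1 (iii) at `X` from Example 3.10's special-fibre tower** (row F-1678
`PiTempNormallyTerminal`: `N_{Π_{X_K}}(Π^temp_{X_K}) = Π^temp_{X_K}`), same leaves.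
[cite: MochizukiSemiAnbd2006, Lem 6.1(iii) p.69] -/
theorem piTempNormallyTerminal_of_specialFibreTower (d : X.GroupLevelData)
    (T : SpecialFibreTower X.DeltaTemp)
    (hP0 : ∀ i, ((T.admKer i).map X.DeltaTemp.subtype).Normal)
    (hlim : ∀ U ∈ 𝓝 (1 : X.DeltaTemp), ∃ i, ∃ V ∈ 𝓝 (1 : (T.chart i).G),
      ∀ n : T.N i, T.adm i n ∈ V → (n : X.DeltaTemp) ∈ U)
    (hch : ∀ i, ∀ V ∈ 𝓝 (1 : (T.chart i).G), ∃ MQ : OpenNormalSubgroup (T.chart i).G,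
      (MQ : Set (T.chart i).G) ⊆ V ∧
      (∀ φ : (T.chart i).G ≃ₜ* (T.chart i).G,
        MQ.toSubgroup.map φ.toMulEquiv.toMonoidHom ≤ MQ.toSubgroup) ∧
      ∃ (G : Subgroup ((T.chart i).G ⧸ MQ.toSubgroup)) (_ : IsFreeGroup G), G.FiniteIndex ∧
        Finite (IsFreeGroup.Generators G) ∧ ∃ a ∈ G, ∃ b ∈ G, a * b ≠ b * a) :
    X.PiTempNormallyTerminal :=
  X.piTempNormallyTerminal_of_tower d.isTempered (X.tower_of_specialFibreTower' d T hP0 hlim hch)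

/-- **[SemiAnbd] Lemma 6.1 (ii) AND (iii) at `X` from Example 3.10's special-fibre tower** — the
`X`-instance of the printed conjunction (row F-1706 `TemperedOrigin.ProfiniteNormalizersHolds`), leaves
(L-η′), (L-Ex310), (L-B1′). [cite: MochizukiSemiAnbd2006, Lem 6.1(ii)-(iii) p.69] -/
theorem profiniteNormalizers_of_specialFibreTower (d : X.GroupLevelData)
    (T : SpecialFibreTower X.DeltaTemp)
    (hP0 : ∀ i, ((T.admKer i).map X.DeltaTemp.subtype).Normal)
    (hlim : ∀ U ∈ 𝓝 (1 : X.DeltaTemp), ∃ i, ∃ V ∈ 𝓝 (1 : (T.chart i).G),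
      ∀ n : T.N i, T.adm i n ∈ V → (n : X.DeltaTemp) ∈ U)
    (hch : ∀ i, ∀ V ∈ 𝓝 (1 : (T.chart i).G), ∃ MQ : OpenNormalSubgroup (T.chart i).G,
      (MQ : Set (T.chart i).G) ⊆ V ∧
      (∀ φ : (T.chart i).G ≃ₜ* (T.chart i).G,
        MQ.toSubgroup.map φ.toMulEquiv.toMonoidHom ≤ MQ.toSubgroup) ∧
      ∃ (G : Subgroup ((T.chart i).G ⧸ MQ.toSubgroup)) (_ : IsFreeGroup G), G.FiniteIndex ∧
        Finite (IsFreeGroup.Generators G) ∧ ∃ a ∈ G, ∃ b ∈ G, a * b ≠ b * a) :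
    X.DeltaTempNormallyTerminal ∧ X.PiTempNormallyTerminal :=
  X.profiniteNormalizers_of_tower d (X.tower_of_specialFibreTower' d T hP0 hlim hch)

/-! ### Lemma 6.3 (ii), (iii) — rows F-1662, F-2837, F-1705 -/

/-- **[SemiAnbd] Lemma 6.3 (iii) for `F = Δ^temp_X` at `X` from Example 3.10's special-fibre tower**
(row F-1662 `DeltaTempDenseDOFConjugator`), leaves (L-η′), (L-Ex310), (L-B1′).
[cite: MochizukiSemiAnbd2006, Lem 6.3(iii) p.70] -/
theorem deltaTempDenseDOFConjugator_of_specialFibreTower (d : X.GroupLevelData)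
    (T : SpecialFibreTower X.DeltaTemp)
    (hP0 : ∀ i, ((T.admKer i).map X.DeltaTemp.subtype).Normal)
    (hlim : ∀ U ∈ 𝓝 (1 : X.DeltaTemp), ∃ i, ∃ V ∈ 𝓝 (1 : (T.chart i).G),
      ∀ n : T.N i, T.adm i n ∈ V → (n : X.DeltaTemp) ∈ U)
    (hch : ∀ i, ∀ V ∈ 𝓝 (1 : (T.chart i).G), ∃ MQ : OpenNormalSubgroup (T.chart i).G,
      (MQ : Set (T.chart i).G) ⊆ V ∧
      (∀ φ : (T.chart i).G ≃ₜ* (T.chart i).G,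
        MQ.toSubgroup.map φ.toMulEquiv.toMonoidHom ≤ MQ.toSubgroup) ∧
      ∃ (G : Subgroup ((T.chart i).G ⧸ MQ.toSubgroup)) (_ : IsFreeGroup G), G.FiniteIndex ∧
        Finite (IsFreeGroup.Generators G) ∧ ∃ a ∈ G, ∃ b ∈ G, a * b ≠ b * a) :
    X.DeltaTempDenseDOFConjugator :=
  (X.denseSubgroups_of_tower d (X.tower_of_specialFibreTower' d T hP0 hlim hch)).2.2.2

/-- **[SemiAnbd] Lemma 6.3 (iii) at the finite étale coverings (`OpenDenseDOFConjugator`, the Thm. 6.4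
sub-node T64-L06′) at `Y` from Example 3.10's special-fibre tower** (row F-2837), leaves (L-η′),
(L-Ex310), (L-B1′). [cite: MochizukiSemiAnbd2006, Lem 6.3(iii) p.70] -/
theorem openDenseDOFConjugator_of_specialFibreTower (d : X.GroupLevelData)
    (T : SpecialFibreTower X.DeltaTemp)
    (hP0 : ∀ i, ((T.admKer i).map X.DeltaTemp.subtype).Normal)
    (hlim : ∀ U ∈ 𝓝 (1 : X.DeltaTemp), ∃ i, ∃ V ∈ 𝓝 (1 : (T.chart i).G),
      ∀ n : T.N i, T.adm i n ∈ V → (n : X.DeltaTemp) ∈ U)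
    (hch : ∀ i, ∀ V ∈ 𝓝 (1 : (T.chart i).G), ∃ MQ : OpenNormalSubgroup (T.chart i).G,
      (MQ : Set (T.chart i).G) ⊆ V ∧
      (∀ φ : (T.chart i).G ≃ₜ* (T.chart i).G,
        MQ.toSubgroup.map φ.toMulEquiv.toMonoidHom ≤ MQ.toSubgroup) ∧
      ∃ (G : Subgroup ((T.chart i).G ⧸ MQ.toSubgroup)) (_ : IsFreeGroup G), G.FiniteIndex ∧
        Finite (IsFreeGroup.Generators G) ∧ ∃ a ∈ G, ∃ b ∈ G, a * b ≠ b * a) :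
    X.OpenDenseDOFConjugator :=
  X.openDenseDOFConjugator_of_tower d.isTempered (X.tower_of_specialFibreTower' d T hP0 hlim hch)

/-- **[SemiAnbd] Lemma 6.3 (ii) and (iii), both cases `F = Π^temp_{X_K}`, `F = Δ^temp_X`, at `X` from
Example 3.10's special-fibre tower** — the `X`-instance of the printed conjunction (row F-1705
`TemperedOrigin.DenseSubgroupsHolds`), leaves (L-η′), (L-Ex310), (L-B1′).
[cite: MochizukiSemiAnbd2006, Lem 6.3(ii)-(iii) p.70] -/
theorem denseSubgroups_of_specialFibreTower (d : X.GroupLevelData)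
    (T : SpecialFibreTower X.DeltaTemp)
    (hP0 : ∀ i, ((T.admKer i).map X.DeltaTemp.subtype).Normal)
    (hlim : ∀ U ∈ 𝓝 (1 : X.DeltaTemp), ∃ i, ∃ V ∈ 𝓝 (1 : (T.chart i).G),
      ∀ n : T.N i, T.adm i n ∈ V → (n : X.DeltaTemp) ∈ U)
    (hch : ∀ i, ∀ V ∈ 𝓝 (1 : (T.chart i).G), ∃ MQ : OpenNormalSubgroup (T.chart i).G,
      (MQ : Set (T.chart i).G) ⊆ V ∧
      (∀ φ : (T.chart i).G ≃ₜ* (T.chart i).G,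
        MQ.toSubgroup.map φ.toMulEquiv.toMonoidHom ≤ MQ.toSubgroup) ∧
      ∃ (G : Subgroup ((T.chart i).G ⧸ MQ.toSubgroup)) (_ : IsFreeGroup G), G.FiniteIndex ∧
        Finite (IsFreeGroup.Generators G) ∧ ∃ a ∈ G, ∃ b ∈ G, a * b ≠ b * a) :
    X.PiTempDFGIffDOF ∧ X.DeltaTempDFGIffDOF ∧ X.PiTempDenseDOFConjugator ∧
      X.DeltaTempDenseDOFConjugator :=
  X.denseSubgroups_of_tower d (X.tower_of_specialFibreTower' d T hP0 hlim hch)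

/-! ### Theorem 6.4 — row F-1693 -/

/-- **[SemiAnbd] Theorem 6.4 for a dominant `C : X → Y` from Example 3.10's special-fibre tower of `Y`**
(row F-1693, `X`/`Y`-instance `TemperedAnabelianTheorem C`): leaves = the printed inputs `h01`
(`GeometricIsDFG C`, F-2831), `h01b` (`GeometricIsGaloisCompatible C`, F-2832), `h04`
(`ProfiniteAnabelianTheorem C` = [Mzk8] Thm. 1.2, F-2836) and, for `Π^temp_{Y_L}`, (L-η′) `d`, (L-Ex310)
`T`, `hP0`, `hlim`, (L-B1′) `hch`; Lemma 6.3 (ii)/(iii) at the coverings are DERIVED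
(`temperedAnabelianTheorem_of_tower`). [cite: MochizukiSemiAnbd2006, Thm 6.4 pp.70-71] -/
theorem temperedAnabelianTheorem_of_specialFibreTower {X Y : TemperedCurve p} (C : TemperedCurveHom p X Y)
    (h01 : GeometricIsDFG C) (h01b : GeometricIsGaloisCompatible C) (h04 : ProfiniteAnabelianTheorem C)
    (d : Y.GroupLevelData) (T : SpecialFibreTower Y.DeltaTemp)
    (hP0 : ∀ i, ((T.admKer i).map Y.DeltaTemp.subtype).Normal)
    (hlim : ∀ U ∈ 𝓝 (1 : Y.DeltaTemp), ∃ i, ∃ V ∈ 𝓝 (1 : (T.chart i).G),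
      ∀ n : T.N i, T.adm i n ∈ V → (n : Y.DeltaTemp) ∈ U)
    (hch : ∀ i, ∀ V ∈ 𝓝 (1 : (T.chart i).G), ∃ MQ : OpenNormalSubgroup (T.chart i).G,
      (MQ : Set (T.chart i).G) ⊆ V ∧
      (∀ φ : (T.chart i).G ≃ₜ* (T.chart i).G,
        MQ.toSubgroup.map φ.toMulEquiv.toMonoidHom ≤ MQ.toSubgroup) ∧
      ∃ (G : Subgroup ((T.chart i).G ⧸ MQ.toSubgroup)) (_ : IsFreeGroup G), G.FiniteIndex ∧
        Finite (IsFreeGroup.Generators G) ∧ ∃ a ∈ G, ∃ b ∈ G, a * b ≠ b * a) :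
    TemperedAnabelianTheorem C :=
  temperedAnabelianTheorem_of_tower C h01 h01b h04 d.isTempered
    (Y.tower_of_specialFibreTower' d T hP0 hlim hch)

/-! ### Theorem 6.6 — row F-1707 -/

/-- **[SemiAnbd] Theorem 6.6 for `X`, `Y` from Example 3.10's special-fibre tower of `Y`** (row F-1707,
`X`/`Y`-instance `X.ProfiniteOuterIsoLifts Y`): leaves = a specialisation isomorphism system for every
`α̂ : Π_{X_K} ⥲ Π_{Y_L}` (the printed proof's [Mzk3] input, `hS`) and, for `Π^temp_{Y_L}`, (L-η′) `d`,
(L-Ex310) `T`, `hP0`, `hlim`, (L-B1′) `hch`; the Lemma 6.1 (iii) input is DERIVED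
(`piTempNormallyTerminal_of_specialFibreTower`). [cite: MochizukiSemiAnbd2006, Thm 6.6 pp.72-73] -/
theorem profiniteOuterIsoLifts_of_system_of_specialFibreTower {X Y : TemperedCurve p}
    (hS : ∀ αhat : X.PiHat ≃ₜ* Y.PiHat, Nonempty (SpecializationIsoSystem X Y αhat))
    (d : Y.GroupLevelData) (T : SpecialFibreTower Y.DeltaTemp)
    (hP0 : ∀ i, ((T.admKer i).map Y.DeltaTemp.subtype).Normal)
    (hlim : ∀ U ∈ 𝓝 (1 : Y.DeltaTemp), ∃ i, ∃ V ∈ 𝓝 (1 : (T.chart i).G),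
      ∀ n : T.N i, T.adm i n ∈ V → (n : Y.DeltaTemp) ∈ U)
    (hch : ∀ i, ∀ V ∈ 𝓝 (1 : (T.chart i).G), ∃ MQ : OpenNormalSubgroup (T.chart i).G,
      (MQ : Set (T.chart i).G) ⊆ V ∧
      (∀ φ : (T.chart i).G ≃ₜ* (T.chart i).G,
        MQ.toSubgroup.map φ.toMulEquiv.toMonoidHom ≤ MQ.toSubgroup) ∧
      ∃ (G : Subgroup ((T.chart i).G ⧸ MQ.toSubgroup)) (_ : IsFreeGroup G), G.FiniteIndex ∧
        Finite (IsFreeGroup.Generators G) ∧ ∃ a ∈ G, ∃ b ∈ G, a * b ≠ b * a) :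
    X.ProfiniteOuterIsoLifts Y :=
  profiniteOuterIsoLifts_of_system hS (Y.piTempNormallyTerminal_of_specialFibreTower d T hP0 hlim hch)

/-! ### From Example 3.10 data to the `htower₀` package of the origin-level closers -/

/-- The origin-level closers of the tree take, per certified curve, `Nonempty X.GroupLevelData ∧ htower₀`;
Example 3.10's data {(L-η′), (L-Ex310), (L-B1′)} supply exactly that (bridge
`tower_of_specialFibreTower'`). [cite: MochizukiSemiAnbd2006, Ex 3.10 pp.44-45] -/
theorem groupLevelData_and_tower_of_specialFibreTower
    (h : Nonempty X.GroupLevelData ∧ ∃ T : SpecialFibreTower X.DeltaTemp,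
      (∀ i, ((T.admKer i).map X.DeltaTemp.subtype).Normal) ∧
      (∀ U ∈ 𝓝 (1 : X.DeltaTemp), ∃ i, ∃ V ∈ 𝓝 (1 : (T.chart i).G),
        ∀ n : T.N i, T.adm i n ∈ V → (n : X.DeltaTemp) ∈ U) ∧
      (∀ i, ∀ V ∈ 𝓝 (1 : (T.chart i).G), ∃ MQ : OpenNormalSubgroup (T.chart i).G,
        (MQ : Set (T.chart i).G) ⊆ V ∧
        (∀ φ : (T.chart i).G ≃ₜ* (T.chart i).G,
          MQ.toSubgroup.map φ.toMulEquiv.toMonoidHom ≤ MQ.toSubgroup) ∧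
        ∃ (G : Subgroup ((T.chart i).G ⧸ MQ.toSubgroup)) (_ : IsFreeGroup G), G.FiniteIndex ∧
          Finite (IsFreeGroup.Generators G) ∧ ∃ a ∈ G, ∃ b ∈ G, a * b ≠ b * a)) :
    Nonempty X.GroupLevelData ∧
      ∀ U ∈ 𝓝 (1 : X.PiTemp), ∃ N : OpenNormalSubgroup X.PiTemp, (N : Set X.PiTemp) ⊆ U ∧
        ∃ (G : Subgroup (X.PiTemp ⧸ N.toSubgroup)) (_ : IsFreeGroup G), G.Normal ∧ G.FiniteIndex ∧
          Finite (IsFreeGroup.Generators G) ∧ ∃ a ∈ G, ∃ b ∈ G, a * b ≠ b * a := by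
  obtain ⟨⟨d⟩, T, hP0, hlim, hch⟩ := h
  exact ⟨⟨d⟩, X.tower_of_specialFibreTower' d T hP0 hlim hch⟩

/-- The same package in the shape `IsTempered X.PiTemp ∧ htower₀` taken by the Thm. 6.4 / Thm. 6.6
origin-level closers. [cite: MochizukiSemiAnbd2006, Ex 3.10 pp.44-45] -/
theorem isTempered_and_tower_of_specialFibreTower
    (h : Nonempty X.GroupLevelData ∧ ∃ T : SpecialFibreTower X.DeltaTemp,
      (∀ i, ((T.admKer i).map X.DeltaTemp.subtype).Normal) ∧
      (∀ U ∈ 𝓝 (1 : X.DeltaTemp), ∃ i, ∃ V ∈ 𝓝 (1 : (T.chart i).G),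
        ∀ n : T.N i, T.adm i n ∈ V → (n : X.DeltaTemp) ∈ U) ∧
      (∀ i, ∀ V ∈ 𝓝 (1 : (T.chart i).G), ∃ MQ : OpenNormalSubgroup (T.chart i).G,
        (MQ : Set (T.chart i).G) ⊆ V ∧
        (∀ φ : (T.chart i).G ≃ₜ* (T.chart i).G,
          MQ.toSubgroup.map φ.toMulEquiv.toMonoidHom ≤ MQ.toSubgroup) ∧
        ∃ (G : Subgroup ((T.chart i).G ⧸ MQ.toSubgroup)) (_ : IsFreeGroup G), G.FiniteIndex ∧
          Finite (IsFreeGroup.Generators G) ∧ ∃ a ∈ G, ∃ b ∈ G, a * b ≠ b * a)) :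
    IsTempered X.PiTemp ∧
      ∀ U ∈ 𝓝 (1 : X.PiTemp), ∃ N : OpenNormalSubgroup X.PiTemp, (N : Set X.PiTemp) ⊆ U ∧
        ∃ (G : Subgroup (X.PiTemp ⧸ N.toSubgroup)) (_ : IsFreeGroup G), G.Normal ∧ G.FiniteIndex ∧
          Finite (IsFreeGroup.Generators G) ∧ ∃ a ∈ G, ∃ b ∈ G, a * b ≠ b * a := by
  obtain ⟨⟨d⟩, T, hP0, hlim, hch⟩ := h
  exact ⟨d.isTempered, X.tower_of_specialFibreTower' d T hP0 hlim hch⟩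

end TemperedCurve

/-! ### The origin-quantified printed statements -/

namespace TemperedOrigin

variable {p : ℕ} [Fact p.Prime]

/-- **[SemiAnbd] Lemma 6.1 (ii), (iii) as printed** (row F-1706 `ProfiniteNormalizersHolds`) from the
origin-level leaves: every certified curve carries (L-η′) group-level parameters and (L-Ex310) an Example
3.10 special-fibre tower with (P0), (h1) and (L-B1′) characteristic André towers at the level charts.
[cite: MochizukiSemiAnbd2006, Lem 6.1(ii)-(iii) p.69] -/
theorem profiniteNormalizersHolds_of_specialFibreTower (Ω : TemperedOrigin p)
    (hEx : ∀ X : TemperedCurve p, Ω.IsHyperbolicCurveOrigin X →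
      Nonempty X.GroupLevelData ∧ ∃ T : SpecialFibreTower X.DeltaTemp,
        (∀ i, ((T.admKer i).map X.DeltaTemp.subtype).Normal) ∧
        (∀ U ∈ 𝓝 (1 : X.DeltaTemp), ∃ i, ∃ V ∈ 𝓝 (1 : (T.chart i).G),
          ∀ n : T.N i, T.adm i n ∈ V → (n : X.DeltaTemp) ∈ U) ∧
        (∀ i, ∀ V ∈ 𝓝 (1 : (T.chart i).G), ∃ MQ : OpenNormalSubgroup (T.chart i).G,
          (MQ : Set (T.chart i).G) ⊆ V ∧
          (∀ φ : (T.chart i).G ≃ₜ* (T.chart i).G,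
            MQ.toSubgroup.map φ.toMulEquiv.toMonoidHom ≤ MQ.toSubgroup) ∧
          ∃ (G : Subgroup ((T.chart i).G ⧸ MQ.toSubgroup)) (_ : IsFreeGroup G), G.FiniteIndex ∧
            Finite (IsFreeGroup.Generators G) ∧ ∃ a ∈ G, ∃ b ∈ G, a * b ≠ b * a)) :
    Ω.ProfiniteNormalizersHolds :=
  Ω.profiniteNormalizersHolds_of_tower fun X hX =>
    X.groupLevelData_and_tower_of_specialFibreTower (hEx X hX)

/-- **[SemiAnbd] Lemma 6.3 (ii), (iii) as printed** (row F-1705 `DenseSubgroupsHolds`) from the same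
origin-level leaves (L-η′), (L-Ex310), (L-B1′). [cite: MochizukiSemiAnbd2006, Lem 6.3(ii)-(iii) p.70] -/
theorem denseSubgroupsHolds_of_specialFibreTower (Ω : TemperedOrigin p)
    (hEx : ∀ X : TemperedCurve p, Ω.IsHyperbolicCurveOrigin X →
      Nonempty X.GroupLevelData ∧ ∃ T : SpecialFibreTower X.DeltaTemp,
        (∀ i, ((T.admKer i).map X.DeltaTemp.subtype).Normal) ∧
        (∀ U ∈ 𝓝 (1 : X.DeltaTemp), ∃ i, ∃ V ∈ 𝓝 (1 : (T.chart i).G),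
          ∀ n : T.N i, T.adm i n ∈ V → (n : X.DeltaTemp) ∈ U) ∧
        (∀ i, ∀ V ∈ 𝓝 (1 : (T.chart i).G), ∃ MQ : OpenNormalSubgroup (T.chart i).G,
          (MQ : Set (T.chart i).G) ⊆ V ∧
          (∀ φ : (T.chart i).G ≃ₜ* (T.chart i).G,
            MQ.toSubgroup.map φ.toMulEquiv.toMonoidHom ≤ MQ.toSubgroup) ∧
          ∃ (G : Subgroup ((T.chart i).G ⧸ MQ.toSubgroup)) (_ : IsFreeGroup G), G.FiniteIndex ∧
            Finite (IsFreeGroup.Generators G) ∧ ∃ a ∈ G, ∃ b ∈ G, a * b ≠ b * a)) :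
    Ω.DenseSubgroupsHolds :=
  Ω.denseSubgroupsHolds_of_tower fun X hX =>
    X.groupLevelData_and_tower_of_specialFibreTower (hEx X hX)

/-- **[SemiAnbd] Theorem 6.6 as printed** (row F-1707 `ProfiniteOuterIsoLiftsHolds`) from the
origin-guarded specialisation-system input of its printed proof (`SpecializationIsoSystemHolds`) and the
origin-level leaves (L-η′), (L-Ex310), (L-B1′) (through which the Lemma 6.1 (iii) input is derived).
[cite: MochizukiSemiAnbd2006, Thm 6.6 pp.72-73] -/
theorem profiniteOuterIsoLiftsHolds_of_specialFibreTower (Ω : TemperedOrigin p)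
    (hS : Ω.SpecializationIsoSystemHolds)
    (hEx : ∀ X : TemperedCurve p, Ω.IsHyperbolicCurveOrigin X →
      Nonempty X.GroupLevelData ∧ ∃ T : SpecialFibreTower X.DeltaTemp,
        (∀ i, ((T.admKer i).map X.DeltaTemp.subtype).Normal) ∧
        (∀ U ∈ 𝓝 (1 : X.DeltaTemp), ∃ i, ∃ V ∈ 𝓝 (1 : (T.chart i).G),
          ∀ n : T.N i, T.adm i n ∈ V → (n : X.DeltaTemp) ∈ U) ∧
        (∀ i, ∀ V ∈ 𝓝 (1 : (T.chart i).G), ∃ MQ : OpenNormalSubgroup (T.chart i).G,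
          (MQ : Set (T.chart i).G) ⊆ V ∧
          (∀ φ : (T.chart i).G ≃ₜ* (T.chart i).G,
            MQ.toSubgroup.map φ.toMulEquiv.toMonoidHom ≤ MQ.toSubgroup) ∧
          ∃ (G : Subgroup ((T.chart i).G ⧸ MQ.toSubgroup)) (_ : IsFreeGroup G), G.FiniteIndex ∧
            Finite (IsFreeGroup.Generators G) ∧ ∃ a ∈ G, ∃ b ∈ G, a * b ≠ b * a)) :
    Ω.ProfiniteOuterIsoLiftsHolds :=
  Ω.profiniteOuterIsoLiftsHolds_of_tower hS fun Y hY =>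
    Y.isTempered_and_tower_of_specialFibreTower (hEx Y hY)

end TemperedOrigin

namespace TemperedMorphismOrigin

variable {p : ℕ} [Fact p.Prime]

/-- **[SemiAnbd] Theorem 6.4 as printed** (row F-1693 `TemperedAnabelianTheoremHolds`) from: the
`π₁^temp`-functor clauses and [Mzk8] Thm. 1.2 for certified dominant morphisms (`hfun`: instance forms
of F-2831, F-2832, F-2836), and the origin-level leaves (L-η′), (L-Ex310), (L-B1′) for every certified
curve. [cite: MochizukiSemiAnbd2006, Thm 6.4 pp.70-71] -/
theorem temperedAnabelianTheoremHolds_of_specialFibreTower (Ω : TemperedMorphismOrigin p)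
    (hfun : ∀ (X Y : TemperedCurve p) (C : TemperedCurveHom p X Y), Ω.IsHyperbolicCurveOrigin X →
      Ω.IsHyperbolicCurveOrigin Y → Ω.IsDomHomOrigin C →
        TemperedCurve.GeometricIsDFG C ∧ TemperedCurve.GeometricIsGaloisCompatible C ∧
          TemperedCurve.ProfiniteAnabelianTheorem C)
    (hEx : ∀ X : TemperedCurve p, Ω.IsHyperbolicCurveOrigin X →
      Nonempty X.GroupLevelData ∧ ∃ T : SpecialFibreTower X.DeltaTemp,
        (∀ i, ((T.admKer i).map X.DeltaTemp.subtype).Normal) ∧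
        (∀ U ∈ 𝓝 (1 : X.DeltaTemp), ∃ i, ∃ V ∈ 𝓝 (1 : (T.chart i).G),
          ∀ n : T.N i, T.adm i n ∈ V → (n : X.DeltaTemp) ∈ U) ∧
        (∀ i, ∀ V ∈ 𝓝 (1 : (T.chart i).G), ∃ MQ : OpenNormalSubgroup (T.chart i).G,
          (MQ : Set (T.chart i).G) ⊆ V ∧
          (∀ φ : (T.chart i).G ≃ₜ* (T.chart i).G,
            MQ.toSubgroup.map φ.toMulEquiv.toMonoidHom ≤ MQ.toSubgroup) ∧
          ∃ (G : Subgroup ((T.chart i).G ⧸ MQ.toSubgroup)) (_ : IsFreeGroup G), G.FiniteIndex ∧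
            Finite (IsFreeGroup.Generators G) ∧ ∃ a ∈ G, ∃ b ∈ G, a * b ≠ b * a)) :
    Ω.TemperedAnabelianTheoremHolds :=
  Ω.temperedAnabelianTheoremHolds_of_tower hfun fun Y hY =>
    Y.isTempered_and_tower_of_specialFibreTower (hEx Y hY)

end TemperedMorphismOrigin

/-! ### Theorem 6.4, concluding step T64-L07 `OuterDescent` — row F-2838 (appended) -/

namespace TemperedCurve

variable {p : ℕ} [Fact p.Prime]

/-- **[SemiAnbd] Thm. 6.4, proof p. 71 ll. 8–11 (T64-L07 `OuterDescent X Y`, row F-2838) from Example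
3.10's special-fibre tower of `Y`**: `Π_{Y_L}`-conjugate DOF-type homomorphisms `Π^temp_{X_K} → Π^temp_{Y_L}`
are `Π^temp_{Y_L}`-conjugate — leaves (L-η′) `d`, (L-Ex310) `T`, `hP0`, `hlim`, (L-B1′) `hch` for `Y`
(Lemma 6.3 (iii) at the coverings is DERIVED: `openDenseDOFConjugator_of_specialFibreTower`, then
abc-iut-w5-d139's `outerDescent_of_openDenseDOFConjugator`). [cite: MochizukiSemiAnbd2006, Thm 6.4 proof p.71] -/
theorem outerDescent_of_specialFibreTower (X Y : TemperedCurve p) (d : Y.GroupLevelData)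
    (T : SpecialFibreTower Y.DeltaTemp)
    (hP0 : ∀ i, ((T.admKer i).map Y.DeltaTemp.subtype).Normal)
    (hlim : ∀ U ∈ 𝓝 (1 : Y.DeltaTemp), ∃ i, ∃ V ∈ 𝓝 (1 : (T.chart i).G),
      ∀ n : T.N i, T.adm i n ∈ V → (n : Y.DeltaTemp) ∈ U)
    (hch : ∀ i, ∀ V ∈ 𝓝 (1 : (T.chart i).G), ∃ MQ : OpenNormalSubgroup (T.chart i).G,
      (MQ : Set (T.chart i).G) ⊆ V ∧
      (∀ φ : (T.chart i).G ≃ₜ* (T.chart i).G,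
        MQ.toSubgroup.map φ.toMulEquiv.toMonoidHom ≤ MQ.toSubgroup) ∧
      ∃ (G : Subgroup ((T.chart i).G ⧸ MQ.toSubgroup)) (_ : IsFreeGroup G), G.FiniteIndex ∧
        Finite (IsFreeGroup.Generators G) ∧ ∃ a ∈ G, ∃ b ∈ G, a * b ≠ b * a) :
    OuterDescent X Y :=
  outerDescent_of_openDenseDOFConjugator X Y (Y.openDenseDOFConjugator_of_specialFibreTower d T hP0 hlim hch)

end TemperedCurve

end Literature.AnabelianGeometry.SemiGraphs

end
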